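import Summits.Ventures.Crystal3D.Theorems.StickyWulffConstantTextureLiminfTexShadowDefs

/-!
# `PolycrystalWulffBound`: closure rules for polyhedral (`Poly`) sets

Route `StickyWulffConstant` of the venture `Summits/Ventures/Crystal3D`, crux `PolycrystalWulffBound`
(item `stmt-Ventures-19482`), second prover lane (poly-p2).  The P stub's and the rungs' hypothesis
`Poly S := ∃ k (H : Fin k → Finset (E3 × ℝ)), S = ⋃ i, polytope (H i)` (finite unions of open
`H`-polytopes) is closed under the operations the rungs use:

* (`∅` is `Poly`: `empty_eq_iUnion_polytope` in `…SubfamilyPerimeter.lean`);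
* `poly_polytope` — one open `H`-polytope;
* `poly_union` — `Poly S → Poly T → Poly (S ∪ T)` (concatenate the piece lists, `Fin (k₁ + k₂)`);
* `poly_inter_polytope` — `Poly S → Poly (S ∩ polytope H₀)` (add the constraints of `H₀` to every
  piece); in particular
* `poly_inter_slab` — `Poly S → Poly (S ∩ {a < ⟪x, m⟫ < b})`: the LAMELLAE
  `E ∩ {a_f < ⟪x, m⟫ < a_{f+1}}` of `rung_basalLamellar` are `Poly`, so the exterior calculus
  (`exists_exterior_crossSums`, `freeEnergy_ge_mul_perimeter`, …) applies to lamellar textures;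
* `poly_inter_halfSpace`.
WHAT THIS IS NOT: anything on perimeters; the crux is not claimed.
-/

noncomputable section

namespace Summit.Ventures.Crystal3D.Theorems

open Set
open scoped RealInnerProductSpace
open Summit.Ventures.Crystal3D.Cruxes.TextureLiminf.TexShadow

/-- One open `H`-polytope is polyhedral. -/
theorem poly_polytope (H₀ : Finset (E3 × ℝ)) :
    ∃ (k : ℕ) (H : Fin k → Finset (E3 × ℝ)), polytope H₀ = ⋃ i, polytope (H i) :=
  ⟨1, fun _ => H₀, by rw [iUnion_const]⟩

/-- **Finite unions**: `Poly S → Poly T → Poly (S ∪ T)`. -/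
theorem poly_union {S T : Set E3}
    (hS : ∃ (k : ℕ) (H : Fin k → Finset (E3 × ℝ)), S = ⋃ i, polytope (H i))
    (hT : ∃ (k : ℕ) (H : Fin k → Finset (E3 × ℝ)), T = ⋃ i, polytope (H i)) :
    ∃ (k : ℕ) (H : Fin k → Finset (E3 × ℝ)), S ∪ T = ⋃ i, polytope (H i) := by
  obtain ⟨k₁, H₁, rfl⟩ := hS
  obtain ⟨k₂, H₂, rfl⟩ := hT
  refine ⟨k₁ + k₂, fun i => Sum.elim H₁ H₂ (finSumFinEquiv.symm i), ?_⟩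
  rw [← iUnion_sumElim (fun i => polytope (H₁ i)) (fun j => polytope (H₂ j))]
  refine iUnion_congr_of_surjective (fun x => finSumFinEquiv x) finSumFinEquiv.surjective
    fun x => ?_
  show polytope (Sum.elim H₁ H₂ (finSumFinEquiv.symm (finSumFinEquiv x))) = _
  rw [Equiv.symm_apply_apply]
  cases x <;> rfl

/-- Adding constraints: `polytope (G ∪ H₀) = polytope G ∩ polytope H₀`. -/
theorem polytope_union_eq_inter (G H₀ : Finset (E3 × ℝ)) :
    polytope (G ∪ H₀) = polytope G ∩ polytope H₀ := by
  classical
  unfold polytope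
  rw [Finset.set_biInter_inter]

/-- **Intersection with an open `H`-polytope**: `Poly S → Poly (S ∩ polytope H₀)`. -/
theorem poly_inter_polytope {S : Set E3}
    (hS : ∃ (k : ℕ) (H : Fin k → Finset (E3 × ℝ)), S = ⋃ i, polytope (H i))
    (H₀ : Finset (E3 × ℝ)) :
    ∃ (k : ℕ) (H : Fin k → Finset (E3 × ℝ)), S ∩ polytope H₀ = ⋃ i, polytope (H i) := by
  classical
  obtain ⟨k, H, rfl⟩ := hS
  refine ⟨k, fun i => H i ∪ H₀, ?_⟩
  rw [iUnion_inter]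
  exact iUnion_congr fun i => (polytope_union_eq_inter (H i) H₀).symm

/-- The open slab `{a < ⟪x, m⟫ < b}` is the open `H`-polytope of the two constraints `(m, b)`,
`(−m, −a)`. -/
theorem slab_eq_polytope (m : E3) (a b : ℝ) :
    {x : E3 | a < ⟪x, m⟫ ∧ ⟪x, m⟫ < b} = polytope ({(m, b), (-m, -a)} : Finset (E3 × ℝ)) := by
  classical
  ext x
  unfold polytope
  simp only [mem_setOf_eq, Finset.mem_insert, Finset.mem_singleton, mem_iInter]
  constructor
  · rintro ⟨ha, hb⟩ p hp
    rcases hp with rfl | rfl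
    · simpa [real_inner_comm] using hb
    · simp only [inner_neg_left, neg_lt_neg_iff]
      rwa [real_inner_comm]
  · intro h
    have hb := h (m, b) (Or.inl rfl)
    have ha := h (-m, -a) (Or.inr rfl)
    simp only [inner_neg_left, neg_lt_neg_iff] at ha hb
    rw [real_inner_comm] at ha hb
    exact ⟨ha, hb⟩

/-- **Intersection with a slab**: `Poly S → Poly (S ∩ {a < ⟪x, m⟫ < b})` — the lamellae of a
polyhedral set are polyhedral. -/
theorem poly_inter_slab {S : Set E3}
    (hS : ∃ (k : ℕ) (H : Fin k → Finset (E3 × ℝ)), S = ⋃ i, polytope (H i)) (m : E3) (a b : ℝ) :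
    ∃ (k : ℕ) (H : Fin k → Finset (E3 × ℝ)),
      S ∩ {x : E3 | a < ⟪x, m⟫ ∧ ⟪x, m⟫ < b} = ⋃ i, polytope (H i) := by
  rw [slab_eq_polytope]
  exact poly_inter_polytope hS _

/-- The open half-space `{⟪x, m⟫ < b}` is the open `H`-polytope of the one constraint `(m, b)`. -/
theorem halfSpace_eq_polytope (m : E3) (b : ℝ) :
    {x : E3 | ⟪x, m⟫ < b} = polytope ({(m, b)} : Finset (E3 × ℝ)) := by
  ext x
  unfold polytope
  simp only [mem_setOf_eq, Finset.mem_singleton, mem_iInter]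
  constructor
  · rintro hb p rfl
    simpa [real_inner_comm] using hb
  · intro h
    have hb := h (m, b) rfl
    simp only at hb
    rwa [real_inner_comm] at hb

/-- **Intersection with a half-space**: `Poly S → Poly (S ∩ {⟪x, m⟫ < b})`. -/
theorem poly_inter_halfSpace {S : Set E3}
    (hS : ∃ (k : ℕ) (H : Fin k → Finset (E3 × ℝ)), S = ⋃ i, polytope (H i)) (m : E3) (b : ℝ) :
    ∃ (k : ℕ) (H : Fin k → Finset (E3 × ℝ)),
      S ∩ {x : E3 | ⟪x, m⟫ < b} = ⋃ i, polytope (H i) := by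
  rw [halfSpace_eq_polytope]
  exact poly_inter_polytope hS _

end Summit.Ventures.Crystal3D.Theorems

end
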